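import Literature.IUT.HodgeArakelov.BadPrimeGaussianMonoidsRestrictionIsoKummerGenericProofs
import Literature.AnabelianGeometry.AbsoluteAnabelian.MLFGaloisModel

/-!
# [IUTchII] Cor 3.5 (ii): the junction hypothesis «unique factorisation `M_TM^× × q_{t₀}^ℕ` at one label» of the
# restriction isomorphism `Ψ^ι_env ⥲ Ψ_ξ` DERIVED from «`q_{t₀}` is not a unit» (= positive valuation), generically
# and at the genuine constant monoid `𝒪^▷_{F̄_v}` — proof-only companion (abc-iut, layer L6, node IUTchII:Cor3.5(ii))

S. Mochizuki, *Inter-universal Teichmüller theory II*, kurims Dec-2020 manuscript: Cor 3.5 (ii) p. 95 ("`Ψ^ι_env(M^Θ_*)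
⥲ Ψ_ξ(M^Θ_*)` … isomorphisms of monoids"), Rmk 2.5.1 (i) p. 72 (the theta values `q_v^{j²}`; for `j ≠ 0` they lie in the
maximal ideal, i.e. have POSITIVE valuation), Prop 3.1 (ii) p. 88 (`Ψ_cns := M_TM ≅ 𝒪^▷_{F̄_v}`)
[cite: Mochizuki2012, Cor 3.5 (ii) p.95]. Claim key DISPUTED (D-0012). PROOF-ONLY companion (abc-iut cell, layer L6,
seat abc-iut-w4-d004 gen 3; node **IUTchII:Cor3.5(ii)**, restriction-ISO clause; sub-DAG row Cor-35.ii.r12).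
NO definition, NO `Prop` fact, NO instance.

WHAT IS IN THE TREE. abc-iut-w4-d004 gen 2's `exists_unique_restrictionIso'_ofKummer_gen`
(`BadPrimeGaussianMonoidsRestrictionIsoKummerGenericProofs.lean`) produces the UNIQUE restriction isomorphism of
Cor 3.5 (ii) from the Kummer data (K), the restriction of constants (R), the theta evaluation (E)
`hRθ : R_t θ = κ₀ (q t)` and, at ONE label `t₀`, the junction hypothesis
`hq₀ : ∀ (m m' : M₀ˣ) (n n'), m * q t₀ ^ n = m' * q t₀ ^ n' → n = n' ∧ m = m'` ("unique factorisation").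

WHAT THIS FILE PROVES (theorems only).
* `uniqueFactorisation_of_not_isUnit`: in ANY commutative monoid with (left) cancellation, a NON-UNIT `q` has unique
  factorisation `units × q^ℕ` — so `hq₀` follows from `¬ IsUnit (q t₀)` alone; `not_isUnit_of_val` /
  `uniqueFactorisation_of_val`: the valuation form (`v` kills the units and `v q ≠ 1`).
* `restriction_injective_gen_of_not_isUnit`, `exists_unique_restrictionIso'_ofKummer_gen_of_not_isUnit`: the
  Cor 3.5 (ii) iso clause of record with `hq₀` REPLACED by the printed hypothesis «`q_{t₀}` non-unit».
* At the GENUINE constant monoid `M₀ = 𝒪^▷_{k̄}` (`nonzeroIntegers k K`, abc-iut-L4-t2's [AbsTopIII] Def 3.1 (i)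
  model = the domain of abc-iut-w4-d007's `h1LimKummerConstants`): `isLeftCancelMul_nonzeroIntegers` (a submonoid of
  the non-zero elements of a field is cancellative), `nonzeroIntegers_isUnit_iff_inv_mem` (a unit of `𝒪^▷_{k̄}` is
  exactly an element whose field inverse is integral) and `nonzeroIntegers_uniqueFactorisation_of_inv_not_mem` /
  `…_of_not_isUnit`: `hq₀` holds for every `q ∈ 𝒪^▷_{k̄}` with `q⁻¹ ∉ 𝒪_{k̄}` (positive valuation; equivalently
  `|q|_sp < 1` — combine by name with abc-iut-L6-t5's `nonzeroIntegers_not_isUnit_of_spectralNorm_lt_one`,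
  `ConstantMonoidRealificationGenuine.lean`, not imported here).
After this file the (E) residual of the Cor 3.5 (ii)/(iii) (and Cor 3.6) iso clauses is EXACTLY the theta-evaluation
identity `hRθ` (Cor 2.8 (i) / [EtTh] Prop 1.4 (iii)). Nothing here asserts a disputed claim or takes a side on
[IUTchIII] Cor 3.12; typed ≠ proved ≠ endorsed.
-/

namespace Literature.IUT.HodgeArakelov

namespace BadPrimeGaussianMonoids

open TemperedThetaMonoids

universe u v w

/-! ### 1. Unique factorisation `units × q^ℕ` of a non-unit in a cancellative commutative monoid -/

section UniqueFactorisation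

variable {M₀ : Type*} [CommMonoid M₀]

/-- One-sided core: with left cancellation, `m · q^n = m' · q^{n+d}` for units `m, m'` and a NON-UNIT `q` forces
`d = 0` and `m = m'` (else `q^d = m'⁻¹ m` would be a unit, hence `q` a unit). Elementary monoid algebra behind
"`q_v^{j²}` of positive valuation" (Rmk 2.5.1 (i)). [cite: Mochizuki2012, Cor 3.5 (ii) p.95] -/
theorem uniqueFactorisation_of_not_isUnit_aux [IsLeftCancelMul M₀] {q : M₀} (hq : ¬ IsUnit q) (m m' : M₀ˣ)
    (n d : ℕ) (h : (m : M₀) * q ^ n = m' * q ^ (n + d)) : d = 0 ∧ m = m' := by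
  have h1 : q ^ n * (m : M₀) = q ^ n * ((m' : M₀) * q ^ d) := by
    rw [mul_comm (q ^ n) (m : M₀), h, pow_add, mul_left_comm, mul_comm (q ^ n)]
  have h2 : (m : M₀) = m' * q ^ d := mul_left_cancel h1
  by_cases hd : d = 0
  · subst hd
    refine ⟨rfl, Units.ext ?_⟩
    simpa using h2
  · exfalso
    apply hq
    have hu : IsUnit (q ^ d) := by
      refine ⟨m'⁻¹ * m, ?_⟩
      rw [Units.val_mul, h2, ← mul_assoc, Units.inv_mul, one_mul]
    exact (isUnit_pow_iff hd).mp hu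

/-- **Unique factorisation `M₀^× × q^ℕ`** of a NON-UNIT `q` in a commutative monoid with cancellation:
`m · q^n = m' · q^{n'}` with `m, m'` units forces `n = n'` and `m = m'` — the junction hypothesis `hq₀` of the
Cor 3.5 (ii) restriction isomorphism, from «`q_{t₀}` non-unit» alone. [cite: Mochizuki2012, Cor 3.5 (ii) p.95] -/
theorem uniqueFactorisation_of_not_isUnit [IsLeftCancelMul M₀] {q : M₀} (hq : ¬ IsUnit q) (m m' : M₀ˣ)
    (n n' : ℕ) (h : (m : M₀) * q ^ n = m' * q ^ n') : n = n' ∧ m = m' := by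
  rcases le_total n n' with hle | hle
  · obtain ⟨d, rfl⟩ := Nat.exists_eq_add_of_le hle
    obtain ⟨hd, hm⟩ := uniqueFactorisation_of_not_isUnit_aux hq m m' n d h
    exact ⟨by omega, hm⟩
  · obtain ⟨d, rfl⟩ := Nat.exists_eq_add_of_le hle
    obtain ⟨hd, hm⟩ := uniqueFactorisation_of_not_isUnit_aux hq m' m n' d h.symm
    exact ⟨by omega, hm.symm⟩

/-- Conversely a UNIT `q` never has unique factorisation (`1 · q^1 = q · q^0`): non-unit is exactly the right
hypothesis. [cite: Mochizuki2012, Cor 3.5 (ii) p.95] -/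
theorem not_uniqueFactorisation_of_isUnit {q : M₀} (hq : IsUnit q) :
    ¬ ∀ (m m' : M₀ˣ) (n n' : ℕ), (m : M₀) * q ^ n = m' * q ^ n' → n = n' ∧ m = m' := by
  intro h
  obtain ⟨u, rfl⟩ := hq
  have := (h 1 u 1 0 (by simp)).1
  exact one_ne_zero this

/-- VALUATION FORM of «non-unit»: if a homomorphism `v : M₀ → Γ` ("valuation"/"order of the divisor") kills the units
and `v q ≠ 1`, then `q` is not a unit. [cite: Mochizuki2012, Rmk 2.5.1 (i) p.72] -/
theorem not_isUnit_of_val {Γ : Type*} [MulOneClass Γ] (v : M₀ →* Γ) (hv : ∀ u : M₀ˣ, v u = 1) {q : M₀}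
    (hq : v q ≠ 1) : ¬ IsUnit q := by
  rintro ⟨u, rfl⟩
  exact hq (hv u)

/-- VALUATION FORM of unique factorisation: units killed by `v`, `v q ≠ 1` ("positive valuation"), cancellation
⇒ `hq₀`. [cite: Mochizuki2012, Rmk 2.5.1 (i) p.72] -/
theorem uniqueFactorisation_of_val [IsLeftCancelMul M₀] {Γ : Type*} [MulOneClass Γ] (v : M₀ →* Γ)
    (hv : ∀ u : M₀ˣ, v u = 1) {q : M₀} (hq : v q ≠ 1) (m m' : M₀ˣ) (n n' : ℕ)
    (h : (m : M₀) * q ^ n = m' * q ^ n') : n = n' ∧ m = m' :=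
  uniqueFactorisation_of_not_isUnit (not_isUnit_of_val v hv hq) m m' n n' h

end UniqueFactorisation

/-! ### 2. The Cor 3.5 (ii) restriction isomorphism with `hq₀` replaced by «`q_{t₀}` non-unit» -/

section KummerJunction

variable {Q : Type u} [Group Q] (E : TemperedThetaMonoids.ThetaEnvData.{u, v} Q) {M₀ : Type*} [CommMonoid M₀]
  [IsLeftCancelMul M₀] (κ : M₀ →* E.H) {T : Type*} {M : Type w} [CommMonoid M] (κ₀ : M₀ →* M) {ι : E.Iota} {θ : E.H}
  (R : T → (E.thetaMonoid ι →* M)) (q : T → M₀)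

/-- **`hinj` from «`q_{t₀}` non-unit»**: the restriction at a label `t₀` whose theta value `q_{t₀} ∈ M_TM` is NOT a
unit (positive valuation, Rmk 2.5.1 (i)) is injective on `Ψ^ι_env` — `restriction_injective_gen` with its
unique-factorisation hypothesis DERIVED (constant monoid cancellative). [cite: Mochizuki2012, Cor 3.5 (ii) p.95] -/
theorem restriction_injective_gen_of_not_isUnit (hκ : Function.Injective κ)
    (hcns : E.constantMonoid = MonoidHom.mrange κ) (hθ : θ ∈ E.thetaEnv ι)
    (horb : ∀ θ' ∈ E.thetaEnv ι, ∃ u ∈ E.units, θ' = u * θ)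
    (hRκ : ∀ (t : T) (m : M₀) (hm : κ m ∈ E.thetaMonoid ι), R t ⟨κ m, hm⟩ = κ₀ m)
    (hRθ : ∀ t, R t ⟨θ, thetaEnv_subset_thetaMonoid E ι hθ⟩ = κ₀ (q t)) (hκ₀ : Function.Injective κ₀) (t₀ : T)
    (hq : ¬ IsUnit (q t₀)) :
    Function.Injective ((R t₀).codRestrict (MonoidHom.mrange κ₀)
      (restriction_mem_mrange_gen E κ κ₀ R q hκ hcns hθ horb hRκ hRθ t₀)) :=
  restriction_injective_gen E κ κ₀ R q hκ hcns hθ horb hRκ hRθ hκ₀ t₀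
    (fun m m' n n' h => uniqueFactorisation_of_not_isUnit hq m m' n n' h)

/-- **IUTchII:Cor3.5(ii)** (kurims p.95) "`Ψ^ι_env(M^Θ_*) ⥲ Ψ_ξ(M^Θ_*)` … isomorphisms of monoids": the UNIQUE
restriction isomorphism of record (`exists_unique_restrictionIso'_ofKummer_gen`) from the Kummer data (K), the
restriction of constants (R), the theta evaluation (E) `R_t θ = κ₀ q_t`, `horb`, and — in place of the
unique-factorisation junction hypothesis `hq₀` — ONLY «`q_{t₀}` is not a unit of `M_TM`» at one label (positive
valuation, Rmk 2.5.1 (i): `q_v^{j²}`, `j ≠ 0`), the constant monoid being cancellative (`M_TM ≅ 𝒪^▷_{F̄_v} ⊆ F̄_v^×`).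
[cite: Mochizuki2012, Cor 3.5 (ii) p.95] -/
theorem exists_unique_restrictionIso'_ofKummer_gen_of_not_isUnit (hκ : Function.Injective κ)
    (hcns : E.constantMonoid = MonoidHom.mrange κ) (hθ : θ ∈ E.thetaEnv ι)
    (horb : ∀ θ' ∈ E.thetaEnv ι, ∃ u ∈ E.units, θ' = u * θ)
    (hRκ : ∀ (t : T) (m : M₀) (hm : κ m ∈ E.thetaMonoid ι), R t ⟨κ m, hm⟩ = κ₀ m)
    (hRθ : ∀ t, R t ⟨θ, thetaEnv_subset_thetaMonoid E ι hθ⟩ = κ₀ (q t)) (hκ₀ : Function.Injective κ₀) (t₀ : T)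
    (hq : ¬ IsUnit (q t₀)) :
    ∃! e : E.thetaMonoid ι ≃*
        gaussianMonoid (fun t => (R t).codRestrict (MonoidHom.mrange κ₀)
          (restriction_mem_mrange_gen E κ κ₀ R q hκ hcns hθ horb hRκ hRθ t)
            ⟨θ, thetaEnv_subset_thetaMonoid E ι hθ⟩),
      ∀ x, ((e x : gaussianMonoid _) : T → MonoidHom.mrange κ₀) =
        MonoidHom.pi (fun t => (R t).codRestrict (MonoidHom.mrange κ₀)
          (restriction_mem_mrange_gen E κ κ₀ R q hκ hcns hθ horb hRκ hRθ t)) x :=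
  exists_unique_restrictionIso'_ofKummer_gen E κ κ₀ R q hκ hcns hθ horb hRκ hRθ hκ₀ t₀
    (fun m m' n n' h => uniqueFactorisation_of_not_isUnit hq m m' n n' h)

/-- VALUATION FORM of the same: a homomorphism `v` on `M_TM` killing the units with `v (q t₀) ≠ 1`.
[cite: Mochizuki2012, Cor 3.5 (ii) p.95] -/
theorem exists_unique_restrictionIso'_ofKummer_gen_of_val {Γ : Type*} [MulOneClass Γ] (v : M₀ →* Γ)
    (hv : ∀ u : M₀ˣ, v u = 1) (hκ : Function.Injective κ)
    (hcns : E.constantMonoid = MonoidHom.mrange κ) (hθ : θ ∈ E.thetaEnv ι)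
    (horb : ∀ θ' ∈ E.thetaEnv ι, ∃ u ∈ E.units, θ' = u * θ)
    (hRκ : ∀ (t : T) (m : M₀) (hm : κ m ∈ E.thetaMonoid ι), R t ⟨κ m, hm⟩ = κ₀ m)
    (hRθ : ∀ t, R t ⟨θ, thetaEnv_subset_thetaMonoid E ι hθ⟩ = κ₀ (q t)) (hκ₀ : Function.Injective κ₀) (t₀ : T)
    (hq : v (q t₀) ≠ 1) :
    ∃! e : E.thetaMonoid ι ≃*
        gaussianMonoid (fun t => (R t).codRestrict (MonoidHom.mrange κ₀)
          (restriction_mem_mrange_gen E κ κ₀ R q hκ hcns hθ horb hRκ hRθ t)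
            ⟨θ, thetaEnv_subset_thetaMonoid E ι hθ⟩),
      ∀ x, ((e x : gaussianMonoid _) : T → MonoidHom.mrange κ₀) =
        MonoidHom.pi (fun t => (R t).codRestrict (MonoidHom.mrange κ₀)
          (restriction_mem_mrange_gen E κ κ₀ R q hκ hcns hθ horb hRκ hRθ t)) x :=
  exists_unique_restrictionIso'_ofKummer_gen_of_not_isUnit E κ κ₀ R q hκ hcns hθ horb hRκ hRθ hκ₀ t₀
    (not_isUnit_of_val v hv hq)

end KummerJunction

/-! ### 3. At the GENUINE constant monoid `𝒪^▷_{k̄}` (`nonzeroIntegers k K`) -/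

section Genuine

open Literature.AnabelianGeometry.AbsoluteAnabelian

variable (k : Type u) [Field k] [ValuativeRel k] (K : Type u) [Field K] [Algebra k K]

/-- `𝒪^▷_{k̄}` is CANCELLATIVE: a submonoid of the non-zero elements of the field `k̄`
([AbsTopIII] Def 3.1 (i) model `nonzeroIntegers`). [cite: MochizukiAbsTopIII2015, Definition 3.1 (i) p.66] -/
theorem isLeftCancelMul_nonzeroIntegers : IsLeftCancelMul (nonzeroIntegers k K) :=
  ⟨fun a _ _ h => Subtype.ext (mul_left_cancel₀ a.2.2 (congrArg Subtype.val h))⟩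

/-- The UNITS of the monoid `𝒪^▷_{k̄}` are exactly the elements whose inverse in the field `k̄` is again integral
(`(𝒪^▷_{k̄})^× = 𝒪_{k̄}^×`); equivalently the non-units are the elements of POSITIVE valuation.
[cite: MochizukiAbsTopIII2015, Definition 3.1 (i) p.66] -/
theorem nonzeroIntegers_isUnit_iff_inv_mem (q : nonzeroIntegers k K) :
    IsUnit q ↔ (q : K)⁻¹ ∈ integersClosure k K := by
  have hq0 : (q : K) ≠ 0 := q.2.2
  constructor
  · intro hu
    obtain ⟨y, hy⟩ := isUnit_iff_exists_inv.mp hu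
    have hy' : (q : K) * (y : K) = 1 := by
      have := congrArg Subtype.val hy
      simpa using this
    have hyinv : (y : K) = (q : K)⁻¹ := by
      rw [← mul_right_inj' hq0, hy', mul_inv_cancel₀ hq0]
    rw [← hyinv]
    exact y.2.1
  · intro hmem
    refine isUnit_iff_exists_inv.mpr ⟨⟨(q : K)⁻¹, hmem, inv_ne_zero hq0⟩, Subtype.ext ?_⟩
    change (q : K) * (q : K)⁻¹ = 1
    exact mul_inv_cancel₀ hq0

/-- **Unique factorisation at the genuine constant monoid**: for `q ∈ 𝒪^▷_{k̄}` of POSITIVE valuation, i.e. whose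
field inverse is not integral (e.g. `q = q_v^{j²}`, `j ≠ 0`, Rmk 2.5.1 (i); equivalently `|q|_sp < 1`,
`nonzeroIntegers_not_isUnit_of_spectralNorm_lt_one`), `m · q^n = m' · q^{n'}` with `m, m'` units of `𝒪^▷_{k̄}`
forces `n = n'`, `m = m'` — the hypothesis `hq₀` of the Cor 3.5 (ii) iso clause HOLDS at `M_TM = 𝒪^▷_{F̄_v}` (the
domain of abc-iut-w4-d007's `h1LimKummerConstants`). [cite: Mochizuki2012, Cor 3.5 (ii) p.95] -/
theorem nonzeroIntegers_uniqueFactorisation_of_inv_not_mem (q : nonzeroIntegers k K)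
    (hq : (q : K)⁻¹ ∉ integersClosure k K) (m m' : (nonzeroIntegers k K)ˣ) (n n' : ℕ)
    (h : (m : nonzeroIntegers k K) * q ^ n = m' * q ^ n') : n = n' ∧ m = m' := by
  haveI := isLeftCancelMul_nonzeroIntegers k K
  exact uniqueFactorisation_of_not_isUnit (fun hu => hq ((nonzeroIntegers_isUnit_iff_inv_mem k K q).mp hu))
    m m' n n' h

/-- The same for every NON-UNIT `q ∈ 𝒪^▷_{k̄}`. [cite: Mochizuki2012, Cor 3.5 (ii) p.95] -/
theorem nonzeroIntegers_uniqueFactorisation_of_not_isUnit (q : nonzeroIntegers k K) (hq : ¬ IsUnit q)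
    (m m' : (nonzeroIntegers k K)ˣ) (n n' : ℕ)
    (h : (m : nonzeroIntegers k K) * q ^ n = m' * q ^ n') : n = n' ∧ m = m' := by
  haveI := isLeftCancelMul_nonzeroIntegers k K
  exact uniqueFactorisation_of_not_isUnit hq m m' n n' h

end Genuine

end BadPrimeGaussianMonoids

end Literature.IUT.HodgeArakelov
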